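import Literature.Barriers.AtomisticToContinuum.OneDimensionalHardCoreToeplitz
import Mathlib.Analysis.SpecialFunctions.Integrals.Basic
import HarnessLib

/-!
# No generalised (band) condensation for impenetrable bosons on the ring (eleventh audit of `OneDimensionalHardCore`, 2026-08-16)

`Literature/Barriers/AtomisticToContinuum/` (D-0021 barrier catalogue), sub-problem
`BoseEinsteinCondensation`. Companion of `OneDimensionalHardCore.lean` (statement, BARRIER block),
`OneDimensionalHardCoreProofs.lean` (`OneDimensionalHardCore_holds`: `c₀(N)/N → 0`),
`OneDimensionalHardCoreNarrow.lean` (uniform mode bound, `girardeauForm`) and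
`OneDimensionalHardCoreToeplitz.lean` (Lenard's Toeplitz formula `ρ_{n+1}(a,b) = L⁻¹R(n, 2π(a-b)/L)`
and the Szegő–Lenard bound `R(n,t) ≤ 2e√(n+1)/√|sin(t/2)|`).

**What is typed and proved here.** For Girardeau's ground state of `N` impenetrable bosons on a
ring of circumference `L`, let `c_m(N) = L⁻¹ Re⟨e_m, γ_N e_m⟩` be the occupation of the plane wave
`e_m(x) = e^{2πimx/L}` (`momentumOccupation`; `c₀(N)` is the parent's `zeroMomentumOccupation`,
`momentumOccupation_zero`) and `B_M(N) = ∑_{|m| ≤ M} c_m(N)` the total occupation of the `2M+1`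
lowest plane-wave modes (`bandOccupation`). Then

* `c_m(n+1) = (2π)⁻¹ ∫₀^{2π} R(n,t) cos(mt) dt` (`momentumOccupation_succ_eq_integral`), hence
  `|c_m(N)| ≤ c₀(N)` for every `m` (`abs_momentumOccupation_le`: the printed "`c_n ≤ c₀`" of the
  `OneDimensionalHardCoreSqrt` entry, caveat (a) of the parent);
* `B_M(n+1) = (2π)⁻¹ ∫₀^{2π} R(n,t) D_M(t) dt` with the Dirichlet kernel
  `D_M(t) = ∑_{|m|≤M} cos(mt)`, `|D_M(t)| ≤ min(2M+1, |sin(t/2)|⁻¹)` (`dirichletKernel`,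
  `abs_dirichletKernel_le`, `abs_sin_half_mul_dirichletKernel_le`);
* **the band law** `B_M(N) ≤ 8e √N √(2M+1)` for ALL `N ≥ 1`, `M ≥ 0`, `L > 0`
  (`bandOccupation_le_sqrt`): Szegő–Lenard times the Dirichlet-kernel bound, split at
  `t₀ = π/(2M+1)`;
* consequently the `2M_N + 1` lowest modes carry `o(N)` particles whenever `M_N = o(N)`
  (`tendsto_bandOccupation_div`), and the generalised-condensation analogue of the conjunct's
  `HasGroundStateBEC` shape fails for every such band (`not_exists_linear_le_bandOccupation`);
  the named fact `OneDimensionalHardCoreBands` records this and is proved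
  (`oneDimensionalHardCoreBands_holds`).

Printed context: for fixed `m`, `c_m(N) ∼ ρ_∞√π Γ(m+¼)Γ(m+¾)⁻¹ √N` [ForresterEtAl2003, §2.2.2],
and in the bulk `n(k) ∝ |k|^{-1/2}` [ForresterEtAl2003, §2.1.4], so `B_M ≍ √(NM)` is the true
order: the exponent `1/2` in `M` cannot be improved, and no band of `o(N)` modes is macroscopically
occupied ("generalised" or type-II/III condensation in the sense of van den Berg–Lewis–Pulé — a
notion going back to [Girardeau1960] — is absent as well).

## References

* [ForresterEtAl2003] P. J. Forrester, N. E. Frankel, T. M. Garoni, N. S. Witte, Phys. Rev. A 67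
  (2003) 043607, arXiv:cond-mat/0211126: §2.1.4, §2.2.1–§2.2.2.
* [DeiftItsKrasovsky2013] P. Deift, A. Its, I. Krasovsky, Comm. Pure Appl. Math. 66 (2013)
  1360–1438, arXiv:1207.4990: Remark 8 (r34-1)–(r34-2) (Szegő's inequality, Lenard's integral).
* [Girardeau1960] M. Girardeau, J. Math. Phys. 1 (1960) 516–523 (the Bose–Fermi map; origin of
  the notion of generalised condensation as credited by van den Berg–Lewis–Pulé; not re-read here,
  acquisition request acq-04195 open).

## Design notes

Everything is stated over the objects of the statement file and of the Narrow/Toeplitz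
companions (`girardeauDensityMatrix`, `zeroMomentumOccupation`, `girardeauForm`, `ez`, `lenardDet`);
no existing statement or definition is changed. One named fact is introduced
(`OneDimensionalHardCoreBands`, D-0026) and proved in this file.
-/

noncomputable section

open MeasureTheory Filter Topology Finset Complex
open scoped BigOperators Real ComplexConjugate

namespace Literature.Barriers.AtomisticToContinuum.BoseGas

variable {L : ℝ}

/-! ### The Dirichlet kernel -/

section Dirichlet

/-- The **Dirichlet kernel** `D_M(t) = ∑_{m=-M}^{M} cos(mt)` (indexed by `k = m + M < 2M+1`).
[folklore] -/
def dirichletKernel (M : ℕ) (t : ℝ) : ℝ :=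
  ∑ k ∈ Finset.range (2 * M + 1), Real.cos (((k : ℝ) - M) * t)

/-- `|D_M(t)| ≤ 2M + 1` (triangle inequality). [folklore] -/
theorem abs_dirichletKernel_le (M : ℕ) (t : ℝ) : |dirichletKernel M t| ≤ 2 * M + 1 := by
  unfold dirichletKernel
  calc |∑ k ∈ Finset.range (2 * M + 1), Real.cos (((k : ℝ) - M) * t)|
      ≤ ∑ k ∈ Finset.range (2 * M + 1), |Real.cos (((k : ℝ) - M) * t)| :=
        Finset.abs_sum_le_sum_abs _ _
    _ ≤ ∑ _k ∈ Finset.range (2 * M + 1), (1 : ℝ) :=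
        Finset.sum_le_sum fun k _ => Real.abs_cos_le_one _
    _ = 2 * M + 1 := by simp

/-- **Telescoping**: `2 sin(t/2) D_M(t) = 2 sin((M + ½) t)`. [folklore] -/
theorem two_mul_sin_half_mul_dirichletKernel (M : ℕ) (t : ℝ) :
    2 * Real.sin (t / 2) * dirichletKernel M t = 2 * Real.sin ((M + 1 / 2) * t) := by
  unfold dirichletKernel
  rw [Finset.mul_sum]
  have hterm : ∀ k : ℕ, 2 * Real.sin (t / 2) * Real.cos (((k : ℝ) - M) * t) =
      Real.sin ((((k + 1 : ℕ) : ℝ) - M - 1 / 2) * t) - Real.sin ((((k : ℕ) : ℝ) - M - 1 / 2) * t) := by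
    intro k
    rw [Real.two_mul_sin_mul_cos]
    have h1 : t / 2 - ((k : ℝ) - M) * t = -((((k : ℕ) : ℝ) - M - 1 / 2) * t) := by ring
    have h2 : t / 2 + ((k : ℝ) - M) * t = (((k + 1 : ℕ) : ℝ) - M - 1 / 2) * t := by
      push_cast; ring
    rw [h1, h2, Real.sin_neg]
    ring
  simp_rw [hterm]
  rw [Finset.sum_range_sub (fun k : ℕ => Real.sin ((((k : ℕ) : ℝ) - M - 1 / 2) * t))]
  have h3 : (((2 * M + 1 : ℕ) : ℝ) - M - 1 / 2) * t = (M + 1 / 2) * t := by push_cast; ring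
  have h4 : (((0 : ℕ) : ℝ) - M - 1 / 2) * t = -((M + 1 / 2) * t) := by push_cast; ring
  rw [h3, h4, Real.sin_neg]
  ring

/-- `|sin(t/2)| · |D_M(t)| ≤ 1`, i.e. `|D_M(t)| ≤ |sin(t/2)|⁻¹` off `2πℤ`. [folklore] -/
theorem abs_sin_half_mul_dirichletKernel_le (M : ℕ) (t : ℝ) :
    |Real.sin (t / 2)| * |dirichletKernel M t| ≤ 1 := by
  have h := two_mul_sin_half_mul_dirichletKernel M t
  have h2 : Real.sin (t / 2) * dirichletKernel M t = Real.sin ((M + 1 / 2) * t) := by linarith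
  rw [← abs_mul, h2]
  exact Real.abs_sin_le_one _

/-- For `u ∈ (0, π]` and any `t` with `|sin(t/2)| = sin(u/2)`: `|D_M(t)| ≤ π/u`
(Jordan's inequality `u/π ≤ sin(u/2)`). [folklore] -/
theorem abs_dirichletKernel_le_div (M : ℕ) {t u : ℝ} (hsin : |Real.sin (t / 2)| = Real.sin (u / 2))
    (hu0 : 0 < u) (huπ : u ≤ π) : |dirichletKernel M t| ≤ π / u := by
  have hsin_ge := div_pi_le_sin_half hu0.le huπ
  have hup : 0 < u / π := by positivity
  have hpos : 0 < Real.sin (u / 2) := lt_of_lt_of_le hup hsin_ge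
  have h := abs_sin_half_mul_dirichletKernel_le M t
  rw [hsin] at h
  have h1 : |dirichletKernel M t| ≤ (Real.sin (u / 2))⁻¹ := by
    rw [← one_div]
    exact (le_div_iff₀' hpos).2 h
  calc |dirichletKernel M t| ≤ (Real.sin (u / 2))⁻¹ := h1
    _ ≤ (u / π)⁻¹ := inv_anti₀ hup hsin_ge
    _ = π / u := by rw [inv_div]

/-- The Dirichlet kernel is continuous. [folklore] -/
theorem continuous_dirichletKernel (M : ℕ) : Continuous (dirichletKernel M) := by
  unfold dirichletKernel
  fun_prop

end Dirichlet

/-! ### Momentum occupations and Lenard's formula per mode -/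

section Modes

variable {n : ℕ}

/-- The **occupation of the plane-wave mode** `e_m(x) = e^{2πimx/L}` in Girardeau's ground state:
`c_m(N) = L⁻¹ Re⟨e_m, γ_N e_m⟩` (`‖e_m‖² = L`; the form is real since `γ_N` is Hermitian — we take
the real part of the typed sesquilinear form `girardeauForm`). For `m = 0` this is the parent's
`zeroMomentumOccupation` (`momentumOccupation_zero`); `∑_m c_m(N) = N`.
[cite: ForresterEtAl2003, §2.2.1] -/
def momentumOccupation (N : ℕ) (L : ℝ) (m : ℤ) : ℝ :=
  L⁻¹ * (girardeauForm N L (ez L m)).re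

/-- The **band occupation** `B_M(N) = ∑_{m=-M}^{M} c_m(N)`: the total occupation of the `2M+1`
lowest plane-wave modes (indexed by `k = m + M < 2M+1`). [cite: ForresterEtAl2003, §2.2.1] -/
def bandOccupation (N : ℕ) (L : ℝ) (M : ℕ) : ℝ :=
  ∑ k ∈ Finset.range (2 * M + 1), momentumOccupation N L ((k : ℤ) - M)

/-- The zero mode recovers the parent's zero-momentum occupation: `c₀(N)` of the statement file.
[cite: ForresterEtAl2003, §2.2.1] -/
theorem momentumOccupation_zero (hL : 0 < L) (N : ℕ) :
    momentumOccupation N L 0 = zeroMomentumOccupation N L := by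
  unfold momentumOccupation
  rw [show ez L 0 = fun _ => (1 : ℂ) from funext fun x => ez_zero L x, girardeauForm_const_one hL,
    Complex.ofReal_re, ← mul_assoc, inv_mul_cancel₀ hL.ne', one_mul]

/-- The band `M = 0` is the zero mode alone: `B₀(N) = c₀(N)`. [cite: ForresterEtAl2003, §2.2.1] -/
theorem bandOccupation_zero (hL : 0 < L) (N : ℕ) :
    bandOccupation N L 0 = zeroMomentumOccupation N L := by
  simp [bandOccupation, momentumOccupation_zero hL]

/-- The mode kernel `R(n, t) e^{-imt}` (Lenard's determinant against the `m`-th character).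
[folklore] -/
def modeKernel (n : ℕ) (m : ℤ) (t : ℝ) : ℂ := (lenardDet n t : ℂ) * cexp (↑(-(m * t)) * I)

/-- The mode kernel is continuous. [folklore] -/
theorem continuous_modeKernel (n : ℕ) (m : ℤ) : Continuous (modeKernel n m) := by
  unfold modeKernel
  exact (continuous_ofReal.comp (continuous_lenardDet n)).mul (by fun_prop)

/-- The mode kernel is `2π`-periodic. [folklore] -/
theorem modeKernel_periodic (n : ℕ) (m : ℤ) : Function.Periodic (modeKernel n m) (2 * π) := by
  intro t
  unfold modeKernel
  rw [lenardDet_periodic n t]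
  congr 1
  rw [show (↑(-(m * (t + 2 * π))) : ℂ) * I = ↑(-(m * t)) * I + (-m : ℤ) * (2 * π * I) by
    push_cast; ring, Complex.exp_add, Complex.exp_int_mul_two_pi_mul_I, mul_one]

/-- `Re(R(n,t) e^{-imt}) = R(n,t) cos(mt)`. [folklore] -/
theorem modeKernel_re (n : ℕ) (m : ℤ) (t : ℝ) :
    (modeKernel n m t).re = lenardDet n t * Real.cos (m * t) := by
  unfold modeKernel
  rw [Complex.re_ofReal_mul, Complex.exp_ofReal_mul_I_re, Real.cos_neg]

/-- `conj e_m(x) · e_m(y) = e^{2πim(y-x)/L}`. [folklore] -/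
theorem conj_ez_mul_ez (L : ℝ) (m : ℤ) (x y : ℝ) :
    conj (ez L m x) * ez L m y = cexp (↑(2 * π * m * (y - x) / L) * I) := by
  rw [conj_ez]
  unfold ez
  rw [← Complex.exp_add]
  congr 1
  push_cast
  ring

/-- The integrand of `⟨e_m, γ_{n+1} e_m⟩` is `L⁻¹ R(n, 2π(x-y)/L) e^{-2πim(x-y)/L}` (Lenard's
formula, real form, times the character). [cite: ClaeysKrasovsky2015, §1 (LdefR), (Ldet)] -/
theorem girardeauIntegrand_ez (hL : 0 < L) (n : ℕ) (m : ℤ) (x y : ℝ) :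
    conj (ez L m x) * (girardeauDensityMatrix (n + 1) L x y : ℂ) * ez L m y =
      ((L⁻¹ : ℝ) : ℂ) * modeKernel n m (2 * π * (x - y) / L) := by
  rw [mul_comm (conj (ez L m x)) _, mul_assoc, conj_ez_mul_ez, girardeauDensityMatrix_eq_lenardDet hL]
  unfold modeKernel
  push_cast
  rw [mul_assoc]
  congr 2
  congr 1
  ring

/-- **Lenard's formula for the `m`-th mode**: `⟨e_m, γ_{n+1} e_m⟩ = (L/2π) ∫₀^{2π} R(n,t) e^{-imt} dt`.
[cite: ClaeysKrasovsky2015, §1 (Lrho0)] [cite: ForresterEtAl2003, §2.2.1] -/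
theorem girardeauForm_ez (hL : 0 < L) (n : ℕ) (m : ℤ) :
    girardeauForm (n + 1) L (ez L m) =
      ((L / (2 * π) : ℝ) : ℂ) * ∫ t in (0 : ℝ)..2 * π, modeKernel n m t := by
  set G : ℝ → ℂ := fun u => modeKernel n m (2 * π * u / L) with hG
  have hper : Function.Periodic G L := by
    intro u
    simp only [hG]
    rw [show 2 * π * (u + L) / L = 2 * π * u / L + 2 * π by field_simp]
    exact modeKernel_periodic n m _
  have hc : (2 * π / L : ℝ) ≠ 0 := by positivity
  have hscale : ∫ u in (0 : ℝ)..L, G u =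
      ((L / (2 * π) : ℝ) : ℂ) * ∫ t in (0 : ℝ)..2 * π, modeKernel n m t := by
    have h := intervalIntegral.integral_comp_mul_left (a := 0) (b := L) (modeKernel n m) hc
    rw [mul_zero, show 2 * π / L * L = 2 * π by field_simp, Complex.real_smul] at h
    rw [show G = fun u => modeKernel n m (2 * π / L * u) from
      funext fun u => by simp only [hG]; ring_nf, h]
    congr 1
    push_cast
    field_simp
  have hinner : ∀ x : ℝ,
      ∫ y in Set.Icc 0 L, conj (ez L m x) * (girardeauDensityMatrix (n + 1) L x y : ℂ) * ez L m y =
        ((L⁻¹ : ℝ) : ℂ) * (((L / (2 * π) : ℝ) : ℂ) * ∫ t in (0 : ℝ)..2 * π, modeKernel n m t) := by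
    intro x
    simp_rw [girardeauIntegrand_ez hL]
    rw [integral_Icc_eq_integral_Ioc, ← intervalIntegral.integral_of_le hL.le,
      intervalIntegral.integral_const_mul]
    congr 1
    have h1 : ∫ y in (0 : ℝ)..L, modeKernel n m (2 * π * (x - y) / L) =
        ∫ u in x - L..x - 0, G u :=
      intervalIntegral.integral_comp_sub_left G x
    rw [h1, sub_zero]
    have h2 := hper.intervalIntegral_add_eq (x - L) 0
    rw [show x - L + L = x by ring, zero_add] at h2
    rw [h2, hscale]
  unfold girardeauForm
  simp_rw [hinner]
  rw [setIntegral_const, Real.volume_real_Icc_of_le hL.le, sub_zero, Complex.real_smul, ← mul_assoc,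
    ← mul_assoc]
  congr 1
  rw [← Complex.ofReal_mul, mul_inv_cancel₀ hL.ne', Complex.ofReal_one, one_mul]

/-- The mode kernel is interval integrable. [folklore] -/
theorem intervalIntegrable_modeKernel (n : ℕ) (m : ℤ) (a b : ℝ) :
    IntervalIntegrable (modeKernel n m) volume a b :=
  (continuous_modeKernel n m).intervalIntegrable a b

/-- **Lenard's formula per mode, real form**: `c_m(n+1) = (2π)⁻¹ ∫₀^{2π} R(n,t) cos(mt) dt`
(independent of `L`). [cite: ForresterEtAl2003, §2.2.1] [cite: ClaeysKrasovsky2015, §1 (Lrho0)] -/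
theorem momentumOccupation_succ_eq_integral (hL : 0 < L) (n : ℕ) (m : ℤ) :
    momentumOccupation (n + 1) L m =
      (2 * π)⁻¹ * ∫ t in (0 : ℝ)..2 * π, lenardDet n t * Real.cos (m * t) := by
  unfold momentumOccupation
  rw [girardeauForm_ez hL n m, Complex.re_ofReal_mul]
  have hre : (∫ t in (0 : ℝ)..2 * π, modeKernel n m t).re =
      ∫ t in (0 : ℝ)..2 * π, lenardDet n t * Real.cos (m * t) := by
    have h := (Complex.reCLM).intervalIntegral_comp_comm (intervalIntegrable_modeKernel n m 0 (2 * π))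
    simp only [Complex.reCLM_apply, modeKernel_re] at h
    exact h.symm
  rw [hre, ← mul_assoc]
  congr 1
  field_simp

/-- **`|c_m(N)| ≤ c₀(N)` for every mode** (positivity of Lenard's determinant): the zero mode is the
most occupied plane wave. [cite: ForresterEtAl2003, §2.2.1–§2.2.2] -/
theorem abs_momentumOccupation_le (hL : 0 < L) (N : ℕ) (m : ℤ) :
    |momentumOccupation N L m| ≤ zeroMomentumOccupation N L := by
  cases N with
  | zero =>
    simp [momentumOccupation, girardeauForm, girardeauDensityMatrix]
  | succ n =>
    rw [momentumOccupation_succ_eq_integral hL, zeroMomentumOccupation_succ_eq_integral hL, abs_mul,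
      abs_of_pos (by positivity : (0 : ℝ) < (2 * π)⁻¹)]
    gcongr
    have h2π : (0 : ℝ) ≤ 2 * π := by positivity
    calc |∫ t in (0 : ℝ)..2 * π, lenardDet n t * Real.cos (m * t)|
        ≤ ∫ t in (0 : ℝ)..2 * π, |lenardDet n t * Real.cos (m * t)| :=
          intervalIntegral.abs_integral_le_integral_abs h2π
      _ ≤ ∫ t in (0 : ℝ)..2 * π, lenardDet n t := by
          refine intervalIntegral.integral_mono_on h2π ?_ ((continuous_lenardDet n).intervalIntegrable _ _)
            fun t _ => ?_
          · exact (((continuous_lenardDet n).mul (by fun_prop)).abs).intervalIntegrable _ _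
          · rw [abs_mul, abs_of_nonneg (lenardDet_nonneg n t)]
            calc lenardDet n t * |Real.cos (m * t)| ≤ lenardDet n t * 1 := by
                  gcongr
                  · exact lenardDet_nonneg n t
                  · exact Real.abs_cos_le_one _
              _ = lenardDet n t := mul_one _

end Modes

/-! ### The band law `B_M(N) ≤ 8e √N √(2M+1)` -/

section BandLaw

variable {n : ℕ}

/-- `∫₀^{t₀} u^{-1/2} du = 2 t₀^{1/2}`. [folklore] -/
theorem integral_rpow_neg_half (t₀ : ℝ) :
    ∫ u in (0 : ℝ)..t₀, u ^ (-(1 / 2 : ℝ)) = 2 * t₀ ^ (1 / 2 : ℝ) := by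
  rw [integral_rpow (Or.inl (by norm_num)), show (-(1 / 2 : ℝ) + 1) = 1 / 2 by norm_num,
    Real.zero_rpow (by norm_num), sub_zero]
  ring

/-- `∫_{t₀}^{π} u^{-3/2} du = 2 t₀^{-1/2} - 2 π^{-1/2}` for `t₀ > 0`. [folklore] -/
theorem integral_rpow_neg_three_half {t₀ : ℝ} (ht₀ : 0 < t₀) :
    ∫ u in t₀..π, u ^ (-(3 / 2 : ℝ)) = 2 * t₀ ^ (-(1 / 2 : ℝ)) - 2 * π ^ (-(1 / 2 : ℝ)) := by
  rw [integral_rpow (Or.inr ⟨by norm_num, Set.notMem_uIcc_of_lt ht₀ Real.pi_pos⟩),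
    show (-(3 / 2 : ℝ) + 1) = -(1 / 2) by norm_num]
  ring

/-- **Abstract half-period estimate.** If a continuous `g` satisfies on `(0, π]` both
`g(u) ≤ A u^{-1/2}` and `g(u) ≤ B u^{-3/2}`, then for every `t₀ ∈ (0, π]`,
`∫₀^π g ≤ 2A t₀^{1/2} + 2B t₀^{-1/2}` (split at `t₀`). [folklore] -/
theorem integral_le_of_two_bounds {g : ℝ → ℝ} (hg : Continuous g) {A B t₀ : ℝ} (hB : 0 ≤ B)
    (ht₀ : 0 < t₀) (ht₀π : t₀ ≤ π)
    (h1 : ∀ u ∈ Set.Ioc (0 : ℝ) π, g u ≤ A * u ^ (-(1 / 2 : ℝ)))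
    (h2 : ∀ u ∈ Set.Ioc (0 : ℝ) π, g u ≤ B * u ^ (-(3 / 2 : ℝ))) :
    ∫ u in (0 : ℝ)..π, g u ≤ 2 * A * t₀ ^ (1 / 2 : ℝ) + 2 * B * t₀ ^ (-(1 / 2 : ℝ)) := by
  have hint : ∀ a b : ℝ, IntervalIntegrable g volume a b := fun a b => hg.intervalIntegrable a b
  have hπ := Real.pi_pos
  have hnear : ∫ u in (0 : ℝ)..t₀, g u ≤ ∫ u in (0 : ℝ)..t₀, A * u ^ (-(1 / 2 : ℝ)) := by
    refine intervalIntegral.integral_mono_on_of_le_Ioo ht₀.le (hint 0 t₀) ?_ fun u hu => ?_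
    · exact (intervalIntegral.intervalIntegrable_rpow' (by norm_num)).const_mul _
    · exact h1 u ⟨hu.1, hu.2.le.trans ht₀π⟩
  have hfar : ∫ u in t₀..π, g u ≤ ∫ u in t₀..π, B * u ^ (-(3 / 2 : ℝ)) := by
    refine intervalIntegral.integral_mono_on ht₀π (hint t₀ π) ?_ fun u hu => ?_
    · refine (intervalIntegral.intervalIntegrable_rpow (Or.inr ?_)).const_mul _
      exact Set.notMem_uIcc_of_lt ht₀ hπ
    · exact h2 u ⟨ht₀.trans_le hu.1, hu.2⟩
  rw [intervalIntegral.integral_const_mul, integral_rpow_neg_half] at hnear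
  rw [intervalIntegral.integral_const_mul, integral_rpow_neg_three_half ht₀] at hfar
  rw [← intervalIntegral.integral_add_adjacent_intervals (hint 0 t₀) (hint t₀ π)]
  have hπrpow : 0 ≤ π ^ (-(1 / 2 : ℝ)) := Real.rpow_nonneg hπ.le _
  calc (∫ u in (0 : ℝ)..t₀, g u) + ∫ u in t₀..π, g u
      ≤ A * (2 * t₀ ^ (1 / 2 : ℝ)) + B * (2 * t₀ ^ (-(1 / 2 : ℝ)) - 2 * π ^ (-(1 / 2 : ℝ))) :=
        add_le_add hnear hfar
    _ ≤ A * (2 * t₀ ^ (1 / 2 : ℝ)) + B * (2 * t₀ ^ (-(1 / 2 : ℝ))) := by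
        gcongr
        linarith
    _ = 2 * A * t₀ ^ (1 / 2 : ℝ) + 2 * B * t₀ ^ (-(1 / 2 : ℝ)) := by ring

/-- The Szegő–Lenard constant `K_n = 2e √(n+1)`. [folklore] -/
def szegoConst (n : ℕ) : ℝ := 2 * Real.exp 1 * Real.sqrt (n + 1)

/-- `K_n ≥ 0`. [folklore] -/
theorem szegoConst_nonneg (n : ℕ) : 0 ≤ szegoConst n := by
  unfold szegoConst; positivity

/-- **Pointwise bounds for `R(n,t)|D_M(t)|`** at angular distance `u ∈ (0, π]` from `2πℤ`
(`sin(t/2) = sin(u/2)`): `≤ K_n √π (2M+1) u^{-1/2}` and `≤ K_n π√π u^{-3/2}`.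
[cite: DeiftItsKrasovsky2013, Remark 8 (r34-2)] -/
theorem lenardDet_mul_abs_dirichletKernel_le (n M : ℕ) {t u : ℝ}
    (hsin : Real.sin (t / 2) = Real.sin (u / 2)) (hu0 : 0 < u) (huπ : u ≤ π) :
    lenardDet n t * |dirichletKernel M t| ≤
        szegoConst n * Real.sqrt π * (2 * M + 1) * u ^ (-(1 / 2 : ℝ)) ∧
      lenardDet n t * |dirichletKernel M t| ≤
        szegoConst n * (π * Real.sqrt π) * u ^ (-(3 / 2 : ℝ)) := by
  have hR := lenardDet_le_of_sin n hsin hu0 huπ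
  have hR0 := lenardDet_nonneg n t
  have hD0 := abs_nonneg (dirichletKernel M t)
  have hsin_nonneg : 0 ≤ Real.sin (u / 2) :=
    Real.sin_nonneg_of_nonneg_of_le_pi (by linarith) (by linarith)
  have habs : |Real.sin (t / 2)| = Real.sin (u / 2) := by rw [hsin, abs_of_nonneg hsin_nonneg]
  have hD1 := abs_dirichletKernel_le M t
  have hD2 := abs_dirichletKernel_le_div M habs hu0 huπ
  have hK : 0 ≤ szegoConst n * (Real.sqrt π * u ^ (-(1 / 2 : ℝ))) := by
    have := szegoConst_nonneg n; positivity
  constructor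
  · calc lenardDet n t * |dirichletKernel M t|
        ≤ szegoConst n * (Real.sqrt π * u ^ (-(1 / 2 : ℝ))) * (2 * M + 1) :=
          mul_le_mul hR hD1 hD0 hK
      _ = szegoConst n * Real.sqrt π * (2 * M + 1) * u ^ (-(1 / 2 : ℝ)) := by ring
  · calc lenardDet n t * |dirichletKernel M t|
        ≤ szegoConst n * (Real.sqrt π * u ^ (-(1 / 2 : ℝ))) * (π / u) :=
          mul_le_mul hR hD2 hD0 hK
      _ = szegoConst n * (π * Real.sqrt π) * (u ^ (-(1 / 2 : ℝ)) / u) := by ring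
      _ = szegoConst n * (π * Real.sqrt π) * u ^ (-(3 / 2 : ℝ)) := by
          rw [show (-(3 / 2 : ℝ)) = -(1 / 2) - 1 by norm_num, Real.rpow_sub_one hu0.ne']

/-- **Half-period integral bound**: for `g(u) = R(n, s(u)) |D_M(s(u))|` with `s(u) = u` or
`s(u) = 2π - u`, `∫₀^π g ≤ 4π K_n √(2M+1)`. [folklore] -/
theorem integral_half_le (n M : ℕ) {s : ℝ → ℝ} (hs : Continuous s)
    (hsin : ∀ u, Real.sin (s u / 2) = Real.sin (u / 2)) :
    ∫ u in (0 : ℝ)..π, lenardDet n (s u) * |dirichletKernel M (s u)| ≤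
      4 * π * szegoConst n * Real.sqrt (2 * M + 1) := by
  set K := szegoConst n with hKdef
  have hK0 : 0 ≤ K := szegoConst_nonneg n
  have hπ := Real.pi_pos
  set m : ℝ := 2 * M + 1 with hm
  have hm0 : 0 < m := by rw [hm]; positivity
  have hm1 : 1 ≤ m := by rw [hm]; linarith [(Nat.cast_nonneg M : (0 : ℝ) ≤ M)]
  set t₀ : ℝ := π / m with ht₀def
  have ht₀ : 0 < t₀ := by positivity
  have ht₀π : t₀ ≤ π := by
    rw [ht₀def, div_le_iff₀ hm0]
    nlinarith
  have hg : Continuous fun u => lenardDet n (s u) * |dirichletKernel M (s u)| :=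
    ((continuous_lenardDet n).comp hs).mul ((continuous_dirichletKernel M).comp hs).abs
  have hmain := integral_le_of_two_bounds hg (A := K * Real.sqrt π * m)
    (B := K * (π * Real.sqrt π)) (by positivity) ht₀ ht₀π
    (fun u hu => (lenardDet_mul_abs_dirichletKernel_le n M (hsin u) hu.1 hu.2).1)
    (fun u hu => (lenardDet_mul_abs_dirichletKernel_le n M (hsin u) hu.1 hu.2).2)
  refine hmain.trans (le_of_eq ?_)
  -- evaluate the two terms at `t₀ = π/m`
  have hsqπ : Real.sqrt π * Real.sqrt π = π := Real.mul_self_sqrt hπ.le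
  have h1 : t₀ ^ (1 / 2 : ℝ) = Real.sqrt π / Real.sqrt m := by
    rw [← Real.sqrt_eq_rpow, ht₀def, Real.sqrt_div hπ.le]
  have h2 : t₀ ^ (-(1 / 2 : ℝ)) = Real.sqrt m / Real.sqrt π := by
    rw [Real.rpow_neg ht₀.le, h1, inv_div]
  have hA : 2 * (K * Real.sqrt π * m) * t₀ ^ (1 / 2 : ℝ) = 2 * K * π * Real.sqrt m := by
    rw [h1]
    calc 2 * (K * Real.sqrt π * m) * (Real.sqrt π / Real.sqrt m)
        = 2 * K * (Real.sqrt π * Real.sqrt π) * (m / Real.sqrt m) := by ring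
      _ = 2 * K * π * Real.sqrt m := by rw [hsqπ, Real.div_sqrt]
  have hB : 2 * (K * (π * Real.sqrt π)) * t₀ ^ (-(1 / 2 : ℝ)) = 2 * K * π * Real.sqrt m := by
    rw [h2]
    calc 2 * (K * (π * Real.sqrt π)) * (Real.sqrt m / Real.sqrt π)
        = 2 * K * π * Real.sqrt m * (Real.sqrt π / Real.sqrt π) := by ring
      _ = 2 * K * π * Real.sqrt m := by rw [div_self (Real.sqrt_pos.2 hπ).ne', mul_one]
  rw [hA, hB]
  ring

/-- **The integrated band bound**: `∫₀^{2π} R(n,t) |D_M(t)| dt ≤ 8π K_n √(2M+1)`.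
[cite: DeiftItsKrasovsky2013, Remark 8 (r34-1)–(r34-2)] -/
theorem integral_lenardDet_mul_abs_dirichletKernel_le (n M : ℕ) :
    ∫ t in (0 : ℝ)..2 * π, lenardDet n t * |dirichletKernel M t| ≤
      8 * π * szegoConst n * Real.sqrt (2 * M + 1) := by
  have hg : Continuous fun t => lenardDet n t * |dirichletKernel M t| :=
    (continuous_lenardDet n).mul (continuous_dirichletKernel M).abs
  have hint : ∀ a b : ℝ, IntervalIntegrable (fun t => lenardDet n t * |dirichletKernel M t|)
      volume a b := fun a b => hg.intervalIntegrable a b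
  have hL : ∫ t in (0 : ℝ)..π, lenardDet n t * |dirichletKernel M t| ≤
      4 * π * szegoConst n * Real.sqrt (2 * M + 1) :=
    integral_half_le n M (s := fun u => u) continuous_id (fun _ => rfl)
  have hR : ∫ t in π..2 * π, lenardDet n t * |dirichletKernel M t| ≤
      4 * π * szegoConst n * Real.sqrt (2 * M + 1) := by
    have h := intervalIntegral.integral_comp_sub_left (a := 0) (b := π)
      (fun t => lenardDet n t * |dirichletKernel M t|) (2 * π)
    rw [show 2 * π - π = π by ring, sub_zero] at h
    rw [← h]
    refine integral_half_le n M (s := fun u => 2 * π - u) (by fun_prop) fun u => ?_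
    rw [show (2 * π - u) / 2 = π - u / 2 by ring, Real.sin_pi_sub]
  rw [← intervalIntegral.integral_add_adjacent_intervals (hint 0 π) (hint π (2 * π))]
  linarith

/-- **Band occupation as a single integral**: `B_M(n+1) = (2π)⁻¹ ∫₀^{2π} R(n,t) D_M(t) dt`.
[cite: ForresterEtAl2003, §2.2.1] -/
theorem bandOccupation_succ_eq_integral (hL : 0 < L) (n M : ℕ) :
    bandOccupation (n + 1) L M =
      (2 * π)⁻¹ * ∫ t in (0 : ℝ)..2 * π, lenardDet n t * dirichletKernel M t := by
  unfold bandOccupation dirichletKernel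
  simp_rw [momentumOccupation_succ_eq_integral hL, Finset.mul_sum]
  rw [intervalIntegral.integral_finsetSum, Finset.mul_sum]
  · refine Finset.sum_congr rfl fun k _ => ?_
    push_cast
    rfl
  · intro k _
    exact ((continuous_lenardDet n).mul (by fun_prop)).intervalIntegrable _ _

/-- **The band law (no generalised condensation, quantitative form).** For every `N`, every
`M ≥ 0` and every circumference `L > 0`, the `2M + 1` lowest plane-wave modes of Girardeau's ground
state carry at most `8e √N √(2M+1)` particles:
`|B_M(N)| = |∑_{|m|≤M} c_m(N)| ≤ 8e √N √(2M+1)` (Szegő–Lenard `R(n,t) ≤ 2e√N/√|sin(t/2)|` against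
the Dirichlet kernel `|D_M| ≤ min(2M+1, |sin(t/2)|⁻¹)`, split at `t₀ = π/(2M+1)`); printed order
`B_M ≍ √(NM)` from `n(k) ∝ |k|^{-1/2}`. [cite: ForresterEtAl2003, §2.1.4 and §2.2.2]
[cite: DeiftItsKrasovsky2013, Remark 8 (r34-1)–(r34-2)] -/
theorem abs_bandOccupation_le_sqrt (N M : ℕ) (hL : 0 < L) :
    |bandOccupation N L M| ≤ 8 * Real.exp 1 * Real.sqrt N * Real.sqrt (2 * M + 1) := by
  cases N with
  | zero =>
    have h0 : bandOccupation 0 L M = 0 := by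
      simp [bandOccupation, momentumOccupation, girardeauForm, girardeauDensityMatrix]
    rw [h0, abs_zero]
    positivity
  | succ n =>
    rw [bandOccupation_succ_eq_integral hL n M, abs_mul,
      abs_of_pos (by positivity : (0 : ℝ) < (2 * π)⁻¹)]
    have hπ := Real.pi_pos
    have h2π : (0 : ℝ) ≤ 2 * π := by positivity
    have hle : |∫ t in (0 : ℝ)..2 * π, lenardDet n t * dirichletKernel M t| ≤
        ∫ t in (0 : ℝ)..2 * π, lenardDet n t * |dirichletKernel M t| := by
      calc |∫ t in (0 : ℝ)..2 * π, lenardDet n t * dirichletKernel M t|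
          ≤ ∫ t in (0 : ℝ)..2 * π, |lenardDet n t * dirichletKernel M t| :=
            intervalIntegral.abs_integral_le_integral_abs h2π
        _ = ∫ t in (0 : ℝ)..2 * π, lenardDet n t * |dirichletKernel M t| := by
            refine intervalIntegral.integral_congr fun t _ => ?_
            simp only [abs_mul, abs_of_nonneg (lenardDet_nonneg n t)]
    have h := integral_lenardDet_mul_abs_dirichletKernel_le n M
    unfold szegoConst at h
    calc (2 * π)⁻¹ * |∫ t in (0 : ℝ)..2 * π, lenardDet n t * dirichletKernel M t|
        ≤ (2 * π)⁻¹ * (8 * π * (2 * Real.exp 1 * Real.sqrt (n + 1)) * Real.sqrt (2 * M + 1)) := by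
          gcongr
          exact hle.trans h
      _ = 8 * Real.exp 1 * Real.sqrt ((n + 1 : ℕ) : ℝ) * Real.sqrt (2 * M + 1) := by
          push_cast
          field_simp

/-- One-sided form of the band law: `B_M(N) ≤ 8e √N √(2M+1)`.
[cite: ForresterEtAl2003, §2.2.2] [cite: DeiftItsKrasovsky2013, Remark 8 (r34-1)–(r34-2)] -/
theorem bandOccupation_le_sqrt (N M : ℕ) (hL : 0 < L) :
    bandOccupation N L M ≤ 8 * Real.exp 1 * Real.sqrt N * Real.sqrt (2 * M + 1) :=
  (le_abs_self _).trans (abs_bandOccupation_le_sqrt N M hL)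

/-- **No generalised condensation: bands of `o(N)` plane-wave modes carry `o(N)` particles.**
If `M_N/N → 0` then `B_{M_N}(N)/N → 0` (from `|B_M(N)|/N ≤ 8e √((2M+1)/N)`).
[cite: ForresterEtAl2003, §2.2.2] -/
theorem tendsto_bandOccupation_div (hL : 0 < L) {M : ℕ → ℕ}
    (hM : Tendsto (fun N : ℕ => (M N : ℝ) / N) atTop (𝓝 0)) :
    Tendsto (fun N : ℕ => bandOccupation N L (M N) / N) atTop (𝓝 0) := by
  -- the majorant `8e √((2 M_N + 1)/N) → 0`
  have hratio : Tendsto (fun N : ℕ => (2 * (M N : ℝ) + 1) / N) atTop (𝓝 0) := by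
    have h1 : Tendsto (fun N : ℕ => ((N : ℝ))⁻¹) atTop (𝓝 0) :=
      tendsto_inv_atTop_zero.comp tendsto_natCast_atTop_atTop
    have h := (hM.const_mul 2).add h1
    rw [mul_zero, zero_add] at h
    refine h.congr' ?_
    filter_upwards [Filter.eventually_ge_atTop 1] with N hN
    have hN : (0 : ℝ) < N := by exact_mod_cast hN
    field_simp
  have hmaj : Tendsto (fun N : ℕ => 8 * Real.exp 1 * Real.sqrt ((2 * (M N : ℝ) + 1) / N))
      atTop (𝓝 0) := by
    have h := (Real.continuous_sqrt.tendsto 0).comp hratio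
    rw [Real.sqrt_zero] at h
    simpa using h.const_mul (8 * Real.exp 1)
  refine squeeze_zero_norm' ?_ hmaj
  filter_upwards [Filter.eventually_ge_atTop 1] with N hN
  have hN : (0 : ℝ) < N := by exact_mod_cast hN
  rw [Real.norm_eq_abs, abs_div, abs_of_pos hN, div_le_iff₀ hN]
  calc |bandOccupation N L (M N)| ≤ 8 * Real.exp 1 * Real.sqrt N * Real.sqrt (2 * (M N) + 1) :=
        abs_bandOccupation_le_sqrt N (M N) hL
    _ = 8 * Real.exp 1 * Real.sqrt ((2 * (M N : ℝ) + 1) / N) * N := by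
        rw [Real.sqrt_div' _ hN.le, mul_assoc (8 * Real.exp 1), mul_assoc (8 * Real.exp 1)]
        congr 1
        rw [div_mul_eq_mul_div, eq_div_iff (Real.sqrt_pos.2 hN).ne']
        calc Real.sqrt N * Real.sqrt (2 * (M N : ℝ) + 1) * Real.sqrt N
            = Real.sqrt (2 * (M N : ℝ) + 1) * (Real.sqrt N * Real.sqrt N) := by ring
          _ = Real.sqrt (2 * (M N : ℝ) + 1) * N := by rw [Real.mul_self_sqrt hN.le]

/-- **The generalised-condensation analogue of the conjunct's `HasGroundStateBEC` shape fails** for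
every band of `o(N)` plane-wave modes: there is no `c > 0` with `c N ≤ B_{M_N}(N)` for all large
`N`. [cite: ForresterEtAl2003, §2.2.2] -/
theorem not_exists_linear_le_bandOccupation (hL : 0 < L) {M : ℕ → ℕ}
    (hM : Tendsto (fun N : ℕ => (M N : ℝ) / N) atTop (𝓝 0)) :
    ¬ ∃ c : ℝ, 0 < c ∧ ∀ᶠ N : ℕ in atTop, c * N ≤ bandOccupation N L (M N) := by
  rintro ⟨c, hc, hev⟩
  have ht := tendsto_bandOccupation_div hL hM
  have hev' : ∀ᶠ N : ℕ in atTop, c ≤ bandOccupation N L (M N) / N := by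
    filter_upwards [hev, Filter.eventually_ge_atTop 1] with N hN hN1
    have hNpos : (0 : ℝ) < N := by exact_mod_cast hN1
    rwa [le_div_iff₀ hNpos]
  have hlim : c ≤ 0 := ge_of_tendsto ht hev'
  linarith

end BandLaw

end Literature.Barriers.AtomisticToContinuum.BoseGas

namespace Literature.Barriers.AtomisticToContinuum

open BoseGas

/-- **No generalised (band) Bose–Einstein condensation for impenetrable bosons on the ring
(Girardeau–Lenard–Szegő, band form).** For every circumference `L > 0` and every sequence of band
widths `M_N` with `M_N/N → 0`, the total occupation `B_{M_N}(N) = ∑_{|m| ≤ M_N} c_m(N)` of the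
`2M_N + 1` lowest plane-wave modes `e_m = e^{2πimx/L}` in Girardeau's ground state of `N`
impenetrable bosons on the circle is `o(N)`: `B_{M_N}(N)/N → 0` (`bandOccupation`,
`momentumOccupation = L⁻¹Re⟨e_m, γ_N e_m⟩`). Quantitatively, for ALL `N, M, L`:
`|B_M(N)| ≤ 8e √N √(2M+1)` (`abs_bandOccupation_le_sqrt`) and `|c_m(N)| ≤ c₀(N) ≤ 4e√N`
(`abs_momentumOccupation_le`, `oneDimensionalHardCore_sqrt_upper`). Printed: for `N ≫ m`,
`c_m(N) ∼ ρ_∞√π Γ(m+¼)Γ(m+¾)⁻¹ √N`, and for `N ≫ m ≫ 1`, `c_m(N) ∼ ρ_∞√(πN/m)`, matching the bulk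
momentum distribution `c(k) ∼ √(2π)ρ_∞|k/k_F|^{-1/2}` [cite: ForresterEtAl2003, §2.2.2]; `∑_m c_m(N) = N`
[cite: ForresterEtAl2003, §2.2.1]; hence `B_M(N) ≈ 4ρ_∞√(πNM) ≈ 6.6√(NM)` for `1 ≪ M ≪ N` — the typed
constant `8e√2 ≈ 30.8` is not sharp but the order `√(NM)` is.
BARRIER (D-0021), AtomisticToContinuum/BoseEinsteinCondensation:
technique_class: dimension-independent coupling-independent interaction-independent ground-state repulsive-generic generalized-condensation band-occupation
blocks: everything `OneDimensionalHardCore` / `OneDimensionalHardCoreNarrow` block (single-mode `λ_max ≥ cN` by arguments valid verbatim for the impenetrable ring gas in the thermodynamic limit) AND, in addition, every such argument whose conclusion is only GENERALISED (type-II/III, "smeared", "quasi-") condensation — a macroscopic occupation `≥ εN` of a band of `o(N)` lowest momentum modes, e.g. "a lowest shell of width `L⁻¹ ≪ k ≪ ξ⁻¹` carries a positive fraction", "`∑_{|k| ≤ K_N} n_k ≥ εN` with `K_N L → ∞` slowly", or two-step schemes "generalised BEC first (dimension-free), concentration into one mode second (d = 3)" whose first step would transport to `d = 1` — all false for Girardeau's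 gas, where a band of `2M+1` modes carries at most `8e√(N(2M+1))` particles for every `N` (typed here); this sharpens the `OneDimensionalHardCoreSqrt` entry, whose print-level remark `(2m+1)c₀ ≤ 2.76(2m+1)√N` covered bands of `o(√N)` modes only
because: Lenard's Toeplitz formula `ρ_{n+1}(x, y) = L⁻¹R(n, 2π(x−y)/L)` makes `B_M(n+1) = (2π)⁻¹∫₀^{2π} R(n,t) D_M(t) dt` with the Dirichlet kernel `D_M` (`bandOccupation_succ_eq_integral`); Szegő's inequality `R(n,t) ≤ 2e√(n+1)/√|sin(t/2)|` (`lenardDet_le_sqrt`, [cite: DeiftItsKrasovsky2013, Remark 8 (r34-2)]) and `|D_M(t)| ≤ min(2M+1, |sin(t/2)|⁻¹)` give `∫ R|D_M| ≤ 16πe√(n+1)√(2M+1)` after splitting at `t₀ = π/(2M+1)` (`integral_lenardDet_mul_abs_dirichletKernel_le`); physically `n(k) ∝ |k|^{-1/2}` [cite: ForresterEtAl2003, §2.1.4] integrates to `√(NM)` over `|m| ≤ M`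
evasions_known: exactly those of `OneDimensionalHardCore` (i)–(x) and `OneDimensionalHardCoreNarrow` (a)–(c): use `d = 3` essentially, or a weak-coupling (Gross–Pitaevskii / Bogoliubov) mechanism; a band of `cN` modes (`c > 0` fixed) is NOT excluded from carrying a positive fraction (it does: `∑_m c_m = N`), so "generalised condensation" in bands of `Θ(N)` modes is no condensation statement at all
scope_caveats: (a) typed for the ZERO-RANGE impenetrable gas on the PERIODIC ring and PLANE-WAVE bands `{e_m : |m| ≤ M}` only (the natural orbitals of the translation-invariant state); bands of arbitrary orthonormal modes are covered only through the Narrow entry's uniform single-mode bound (`(2M+1)·εN`, i.e. bands of `O(1)` modes); hard rods, walls and traps: not typed in band form (single-mode forms: `OneDimensionalHardRods`, `OneDimensionalHardCoreDirichlet`); (b) `c_m ≥ 0` (positivity of `γ_N`) is not typed — only `|c_m| ≤ c₀` — so the bound is stated for `|B_M|`; (c) the constant `8e` is not sharp (printed `B_M ∼ C√(NM)`-type laws follow from [cite: ForresterEtAl2003, §2.2.2] but are not typed); (d) [cite: Lenard1964, as restated in DeiftItsKrasovsky2013 Remark 8] not re-read (cite-only, acq-00347)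
status: established (proved below, `oneDimensionalHardCoreBands_holds`, from the tree's Szegő–Lenard bound; eleventh audit of `OneDimensionalHardCore`, 2026-08-16)
[cite: ForresterEtAl2003, §2.2.2] [cite: DeiftItsKrasovsky2013, Remark 8 (r34-1)–(r34-2)] -/
def OneDimensionalHardCoreBands : Prop :=
  ∀ L : ℝ, 0 < L → ∀ M : ℕ → ℕ, Tendsto (fun N : ℕ => (M N : ℝ) / N) atTop (𝓝 0) →
    Tendsto (fun N : ℕ => bandOccupation N L (M N) / N) atTop (𝓝 0)

/-- **The band barrier holds** (from `tendsto_bandOccupation_div`).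
[cite: ForresterEtAl2003, §2.2.2] [cite: DeiftItsKrasovsky2013, Remark 8 (r34-1)–(r34-2)] -/
theorem oneDimensionalHardCoreBands_holds : OneDimensionalHardCoreBands :=
  fun _ hL _ hM => tendsto_bandOccupation_div hL hM

/-- Consistency with the parent entry: the band barrier at `M ≡ 0` is `c₀(N)/N → 0`, i.e.
`OneDimensionalHardCore`. [cite: ForresterEtAl2003, §2.2.2] -/
theorem oneDimensionalHardCore_of_bands (h : OneDimensionalHardCoreBands) : OneDimensionalHardCore := by
  intro L hL
  have h0 := h L hL (fun _ => 0) (by simp)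
  refine h0.congr' (Eventually.of_forall fun N => ?_)
  simp only
  rw [bandOccupation_zero hL]

end Literature.Barriers.AtomisticToContinuum

end
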